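import Summits.HodgeConjecture.HodgeConjecture.Theorems.K2E1bKTypeTwistDefs
import Literature.RepresentationTheory.BorelWallach2000.UpqCasimirStandardCalibration
import Literature.RepresentationTheory.Kovacevic2021.SU21ModulesFromKTypes
import Literature.Algebra.Lie.CasimirElement
import HarnessLib

/-!
# K2 ∕ E1b · U0 «TWIST INTEGRATION» · FILE #7 — χ-SCALARS OF A CENTRAL TWIST (`Theorems/K2E1bTwistChiScalars.lean`)

Cell hodgecm-mathlib, Track B «K2-LIT», engine E1b «(𝔤,K)-cohomology of U(2,1)»; crux item h413 = stmt-HodgeConjecture-24833;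
socket `sig_K2E1bTwistChiScalars` of the tier-1 module `Cruxes/H413/Lines/K2_E1b_GKCohomologyU21_U0_TwistIntegration.lean`
(statement bytes pasted VERBATIM below as `twistChiScalars`).  Author K2E1b-p05 (g0).  Proof file: theorems only (no `def`,
no `instance`, no notation, no named fact, no `sorry`).

THE STATEMENT.  Let `𝒟` be a Kovačević datum (★ `SU21Datum`: a `𝔤𝔩(3, ℂ)`-module `𝒟.ρ` on `𝒟.V`, centre acting by `0`,
★ `SU21Datum.ρfun_one`) on which the trace-form Casimir `Σ_{i,j} ρ(E_{ij}) ρ(E_{ji})` acts by `κ₀`, and let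
`σ = kovLie 𝒟.ρ + (e∕3)·tr(·)·1` be the central twist (★ `IsTwistOf`, defs leaf `Theorems/K2E1bKTypeTwistDefs`).  Then the
tree's Casimir operator ★ `upqCasimirOp σ = Σ_t σ(y_t) σ(y'_t)` of the trace form `B(X, Y) = Re tr(XY)` of `𝔲(2,1)`
[BorelWallach2000, II §1.3 (1)] acts by `κ₀ + e²∕3`, and every `Z ∈ 𝔲(2,1)` with matrix `i·1` acts by `e·i`.

THE PROOF (the «KW road» of ★ `UpqCasimirStandardCalibration`'s docstring, taken here).
* §1 PARSEVAL ACROSS THE REAL FORM: `𝔲(α, β)` is a real form of `𝔤𝔩(α ⊕ β, ℂ)` (★ `upq_exists_eq_add_I_smul`) and `tr(XY)` is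
  REAL on it (★ `upq_trace_mul_eq_upqTraceForm`), so the real Parseval identity `X = Σ_t B(X, y_t) y'_t` of the `B`-dual bases
  `(y_t) = ` ★ `upqBasis`, `(y'_t) = ` ★ `upqDualBasis` (the tree's ★ `sum_apply_basis_smul_dualBasis`) extends `ℂ`-linearly to
  `M = Σ_t tr(M y_t) · y'_t` for EVERY complex matrix `M` (`sum_trace_mul_smul_upqDualBasis`).
* §2 Hence the canonical tensor of the trace form is `Σ_t y_t ⊗ y'_t = Σ_{i,j} E_{ij} ⊗ E_{ji}`: for every `ℂ`-bilinear `Φ`,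
  `Σ_t Φ(y_t, y'_t) = Σ_{i,j} Φ(E_{ij}, E_{ji})` (`sum_bilin_eq_of_parseval`, pure matrix algebra; [Knapp2002, V §4 (5.25)]).
* §3 With `Φ(M, N) = τ(M) τ(N)` for the complex-linear extension `τ(M) = ρ(M̃) + (e∕3) tr(M)·1` of `σ` (`M̃` = `M` reindexed
  along `Fin 2 ⊕ Fin 1 ≃ Fin 3`): `C_σ = Σ_{a,b} (ρ(E_{ab}) + (e∕3)δ_{ab})(ρ(E_{ba}) + (e∕3)δ_{ab}) = Σ ρ(E_{ab})ρ(E_{ba}) + (2e∕3) ρ(1)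
  + 3 (e∕3)² = κ₀ + 0 + e²∕3`; and `σ(Z) = ρ(i·1) + (e∕3) tr(i·1) = 0 + e·i` [Rogawski1990, §12.3 p. 177: the centre acts on
  `i_G(χ)` through the central character of `F_φ`].
CALIBRATION: `𝒟 = trivialMod` (`κ₀ = 0`) twisted by `e = 3m` gives `3m²` — the value of ★ `upqDetChar_casimir` on `det^m`
(`κ(m+1, m, m−1) = 3m²` in the normalisation `χ_Λ(C) = ⟨Λ,Λ⟩ − ⟨ρ,ρ⟩` of [BorelWallach2000, II Prop. 6.12 (2)]).

HONEST LABEL: HC_CM is proved only modulo the 7 printed citations (2 remaining named inputs: hLiu418 = stmt-HodgeConjecture-24832,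
h413 = stmt-HodgeConjecture-24833) until rung 0 closes; this file pays ONE tier-1 socket of ONE engine line and nothing else.

## References
* A. Borel, N. Wallach, *Continuous cohomology, discrete subgroups, and representations of reductive groups*, 2nd ed., Math.
  Surveys Monogr. 67, AMS (2000): II §1.1 (3)–(5), §1.3 (1)–(2) (the Casimir element of `B`, independent of the basis),
  II Prop. 6.12 (2). [BorelWallach2000]
* A. W. Knapp, *Lie Groups Beyond an Introduction*, 2nd ed. (2002): I §1 Example (3) (`𝔲(p,q)` is a real form of `𝔤𝔩(p+q, ℂ)`),
  V §4 (5.24)–(5.25) (basis independence of the Casimir element). [Knapp2002]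
* J. Rogawski, *Automorphic representations of unitary groups in three variables*, Ann. of Math. Stud. 123 (1990), §12.3
  pp. 176–178. [Rogawski1990]
-/

set_option autoImplicit false
set_option linter.dupNamespace false

noncomputable section

namespace Summit.HodgeConjecture.HodgeConjecture.Cruxes.H413.K2E1bTwistChiScalars

open Literature.Algebra.Lie
open Literature.NumberTheory.Automorphic
open Literature.RepresentationTheory.BorelWallach2000
open Literature.RepresentationTheory.KonnoKonno2007 Literature.RepresentationTheory.KonnoKonno2007.RealDualPair
open Literature.RepresentationTheory.KonnoKonno2007.RealDualPair.UForm
open Literature.RepresentationTheory.Kovacevic2021 Literature.RepresentationTheory.Kovacevic2021.SU21Datum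
open Summit.HodgeConjecture.HodgeConjecture.Cruxes.H413.F0P3bLocalAPacketsDefs
open Summit.HodgeConjecture.HodgeConjecture.Cruxes.H413.F0P3bU21Restriction
open Summit.HodgeConjecture.HodgeConjecture.Cruxes.H413.K2E1bGKCohomologyU21 (IsTwistOf)

-- Mathlib idiom (as in `GKModules`, the `Upq*` files, the Kovačević topic, the defs leaf): commutator bracket on `Module.End` ∕ matrices
attribute [local instance 100] LieRing.ofAssociativeRing

/-! ## §1 Parseval across the real form `𝔲(α, β) ⊂ 𝔤𝔩(α ⊕ β, ℂ)` -/

section Parseval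

variable {α β : Type*} [Fintype α] [DecidableEq α] [Fintype β] [DecidableEq β]

/-- Real scalars on `𝔲(α, β) ≤ 𝔤𝔩(α ⊕ β, ℂ)` act through `ℝ → ℂ` on the underlying matrix. [folklore] -/
theorem coe_real_smul (r : ℝ) (X : (uFormGroup α β).lie) :
    ((r • X : (uFormGroup α β).lie) : Matrix (α ⊕ β) (α ⊕ β) ℂ) = (r : ℂ) • (X : Matrix (α ⊕ β) (α ⊕ β) ℂ) := by
  change r • (X : Matrix (α ⊕ β) (α ⊕ β) ℂ) = _
  rw [Complex.coe_smul]

/-- **Parseval on `𝔲(α, β)` in complex coordinates**: for `X ∈ 𝔲(α, β)`, `X = Σ_t tr(X y_t) · y'_t` for the basis `(y_t)` of ★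
`upqBasis` and its `B`-dual basis `(y'_t)` (★ `upqDualBasis`), because `tr(X y_t) = B(X, y_t)` is real (★ `upq_trace_mul_eq_upqTraceForm`)
and `X = Σ_t B(X, y_t) y'_t` (★ `sum_apply_basis_smul_dualBasis`). [cite: BorelWallach2000, II §1.3 (1)] [cite: Knapp2002, V §4 (5.25)] -/
theorem sum_trace_mul_smul_upqDualBasis_of_mem (X : (uFormGroup α β).lie) :
    ∑ t, (((X : Matrix (α ⊕ β) (α ⊕ β) ℂ) * ((upqBasis α β t : (uFormGroup α β).lie) : Matrix (α ⊕ β) (α ⊕ β) ℂ)).trace) •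
        ((upqDualBasis α β t : (uFormGroup α β).lie) : Matrix (α ⊕ β) (α ⊕ β) ℂ) =
      (X : Matrix (α ⊕ β) (α ⊕ β) ℂ) := by
  have h := sum_apply_basis_smul_dualBasis upqTraceForm_nondegenerate (upqBasis α β) X
  rw [← upqDualBasis] at h
  have h' := congrArg (fun Y : (uFormGroup α β).lie => (Y : Matrix (α ⊕ β) (α ⊕ β) ℂ)) h
  simp only [AddSubmonoidClass.coe_finsetSum, coe_real_smul] at h'
  refine Eq.trans (Finset.sum_congr rfl fun t _ => ?_) h'
  rw [upq_trace_mul_eq_upqTraceForm]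

/-- **Parseval across the real form**: `M = Σ_t tr(M y_t) · y'_t` for EVERY complex matrix `M ∈ 𝔤𝔩(α ⊕ β, ℂ)` — write `M = A + iB`
with `A, B ∈ 𝔲(α, β)` (★ `upq_exists_eq_add_I_smul`: `𝔲(α, β)` is a real form) and use `ℂ`-linearity of both sides; i.e. `(y_t)` is a
complex basis of `𝔤𝔩(α ⊕ β, ℂ)` with `tr`-dual basis `(y'_t)`. [cite: Knapp2002, I §1 Example (3); V §4 (5.25)] [cite: BorelWallach2000, II §1.3 (1)] -/
theorem sum_trace_mul_smul_upqDualBasis (M : Matrix (α ⊕ β) (α ⊕ β) ℂ) :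
    ∑ t, ((M * ((upqBasis α β t : (uFormGroup α β).lie) : Matrix (α ⊕ β) (α ⊕ β) ℂ)).trace) •
        ((upqDualBasis α β t : (uFormGroup α β).lie) : Matrix (α ⊕ β) (α ⊕ β) ℂ) = M := by
  obtain ⟨A, B, rfl⟩ := upq_exists_eq_add_I_smul M
  simp only [Matrix.add_mul, Matrix.smul_mul, Matrix.trace_add, Matrix.trace_smul, smul_eq_mul, add_smul, mul_smul,
    Finset.sum_add_distrib, ← Finset.smul_sum, sum_trace_mul_smul_upqDualBasis_of_mem]

end Parseval

/-! ## §2 The canonical tensor of the trace form is `Σ_{i,j} E_{ij} ⊗ E_{ji}` (bilinear-map form) -/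

/-- **`Σ_t Φ(y_t, y'_t) = Σ_{i,j} Φ(E_{ij}, E_{ji})`** for every `ℂ`-bilinear `Φ` and every pair of finite families `(y_t)`, `(y'_t)` of
complex matrices with the Parseval property `M = Σ_t tr(M y_t) · y'_t` (then `Σ_t (y_t)_{ij} · y'_t = E_{ji}`, and one expands
`y_t = Σ_{ij} (y_t)_{ij} E_{ij}`): the canonical tensor `Σ_t y_t ⊗ y'_t` of the trace form is `Σ_{i,j} E_{ij} ⊗ E_{ji}`, whatever the dual
bases. [cite: Knapp2002, V §4 (5.24)–(5.25)] -/
theorem sum_bilin_eq_of_parseval {ι n W : Type*} [Fintype ι] [Fintype n] [DecidableEq n] [AddCommMonoid W] [Module ℂ W]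
    (y y' : ι → Matrix n n ℂ) (h : ∀ M : Matrix n n ℂ, ∑ t, ((M * y t).trace) • y' t = M)
    (Φ : Matrix n n ℂ →ₗ[ℂ] Matrix n n ℂ →ₗ[ℂ] W) :
    ∑ t, Φ (y t) (y' t) = ∑ i, ∑ j, Φ (Matrix.single i j 1) (Matrix.single j i 1) := by
  have key : ∀ i j : n, ∑ t, y t i j • y' t = Matrix.single j i (1 : ℂ) := fun i j => by
    have h1 := h (Matrix.single j i 1)
    simp only [Matrix.trace_single_mul, smul_eq_mul, one_mul] at h1
    exact h1
  calc ∑ t, Φ (y t) (y' t)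
      = ∑ t, ∑ i, ∑ j, y t i j • Φ (Matrix.single i j 1) (y' t) := by
        refine Finset.sum_congr rfl fun t _ => ?_
        conv_lhs => rw [Matrix.matrix_eq_sum_single (y t)]
        rw [map_sum, LinearMap.sum_apply]
        refine Finset.sum_congr rfl fun i _ => ?_
        rw [map_sum, LinearMap.sum_apply]
        refine Finset.sum_congr rfl fun j _ => ?_
        rw [show Matrix.single i j (y t i j) = y t i j • Matrix.single i j (1 : ℂ) by
          rw [Matrix.smul_single, smul_eq_mul, mul_one], map_smul, LinearMap.smul_apply]
    _ = ∑ i, ∑ j, ∑ t, y t i j • Φ (Matrix.single i j 1) (y' t) := by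
        rw [Finset.sum_comm]
        refine Finset.sum_congr rfl fun i _ => ?_
        rw [Finset.sum_comm]
    _ = ∑ i, ∑ j, Φ (Matrix.single i j 1) (Matrix.single j i 1) := by
        refine Finset.sum_congr rfl fun i _ => Finset.sum_congr rfl fun j _ => ?_
        rw [← key i j, map_sum]
        refine Finset.sum_congr rfl fun t _ => ?_
        rw [map_smul]

/-- `Σ_a E_{aa} = 1` in `𝔤𝔩(n)`. [folklore] -/
theorem sum_single_diag_eq_one {n : Type*} [Fintype n] [DecidableEq n] :
    ∑ a : n, Matrix.single a a (1 : ℂ) = 1 := by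
  ext i j
  simp only [Matrix.sum_apply, Matrix.single_apply, Matrix.one_apply, ite_and, Finset.sum_ite_eq', Finset.mem_univ, if_true]

/-! ## §3 The socket `sig_K2E1bTwistChiScalars` (statement bytes VERBATIM) -/

/-- **FILE `Theorems/K2E1bTwistChiScalars.lean` — χ-SCALARS OF A TWIST** (socket `U0.sig_K2E1bTwistChiScalars`, bytes verbatim).  If
Kovačević's trace-form Casimir `Σ_{ij} ⁅E_ij, ⁅E_ji, ·⁆⁆` acts on `𝒟.V` by `κ₀`, then on the central twist `σ` of `𝒟.ρ` by `e∕3` the tree's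
trace-form Casimir ★ `upqCasimirOp σ` acts by `κ₀ + e²∕3` (the canonical tensor of `Re tr(XY)` on `𝔲(2,1)` is `Σ E_{ij} ⊗ E_{ji}`, §2; the cross
terms are `(2e∕3)·ρ(1) = 0` by ★ `ρfun_one`, and `3·(e∕3)² = e²∕3`), and every `Z` with matrix `i·1` acts by `e·i` (`ρ(i·1) = 0`, `tr(i·1) = 3i`).
[cite: BorelWallach2000, II §1.3 (1)–(2); II Prop. 6.12 (2)] [cite: Rogawski1990, §12.3 p. 177] [cite: Knapp2002, V §4 (5.25)] -/
theorem twistChiScalars :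
    ∀ (𝒟 : SU21Datum) (e : ℤ) (κ₀ : ℂ), (∀ v : 𝒟.V, (∑ i : Fin 3, ∑ j : Fin 3, ⁅E i j, ⁅E j i, v⁆⁆) = κ₀ • v) →
      ∀ (σ : G21.lie →ₗ⁅ℝ⁆ Module.End ℂ 𝒟.V), IsTwistOf 𝒟.ρ ((e : ℂ) / 3) σ →
        (∀ v : 𝒟.V, upqCasimirOp σ v = (κ₀ + (e : ℂ) ^ 2 / 3) • v) ∧
          ∀ Z : G21.lie, (Z : Matrix (Fin 2 ⊕ Fin 1) (Fin 2 ⊕ Fin 1) ℂ) = Complex.I • (1 : Matrix (Fin 2 ⊕ Fin 1) (Fin 2 ⊕ Fin 1) ℂ) →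
            ∀ v : 𝒟.V, σ Z v = ((e : ℂ) * Complex.I) • v := by
  intro 𝒟 e κ₀ hκ σ hσ
  -- the complex-linear extension `τ(M) = ρ(M̃) + z·tr(M)·1` of `σ` to `𝔤𝔩(Fin 2 ⊕ Fin 1, ℂ)`, `z = e∕3`
  set z : ℂ := (e : ℂ) / 3 with hz
  let τ : Matrix (Fin 2 ⊕ Fin 1) (Fin 2 ⊕ Fin 1) ℂ →ₗ[ℂ] Module.End ℂ 𝒟.V :=
    { toFun := fun M =>
        𝒟.ρ (Matrix.reindex (finSumFinEquiv : Fin 2 ⊕ Fin 1 ≃ Fin 3) (finSumFinEquiv : Fin 2 ⊕ Fin 1 ≃ Fin 3) M) +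
          (z * M.trace) • (1 : Module.End ℂ 𝒟.V)
      map_add' := fun M N => by
        simp only [Matrix.reindex_apply, Matrix.submatrix_add, Pi.add_apply, map_add, Matrix.trace_add, mul_add, add_smul]
        abel
      map_smul' := fun c M => by
        simp only [Matrix.reindex_apply, Matrix.submatrix_smul, Pi.smul_apply, map_smul, Matrix.trace_smul, smul_eq_mul,
          RingHom.id_apply, smul_add, smul_smul, mul_left_comm c z] }
  have hτ : ∀ M : Matrix (Fin 2 ⊕ Fin 1) (Fin 2 ⊕ Fin 1) ℂ, τ M =
      𝒟.ρ (Matrix.reindex (finSumFinEquiv : Fin 2 ⊕ Fin 1 ≃ Fin 3) (finSumFinEquiv : Fin 2 ⊕ Fin 1 ≃ Fin 3) M) +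
        (z * M.trace) • (1 : Module.End ℂ 𝒟.V) := fun M => rfl
  have hστ : ∀ X : G21.lie, σ X = τ (X : Matrix (Fin 2 ⊕ Fin 1) (Fin 2 ⊕ Fin 1) ℂ) := fun X => by
    rw [hσ X, kovLie_apply, hτ]
  -- `τ` on the matrix units
  have hτE : ∀ i j : Fin 2 ⊕ Fin 1, τ (Matrix.single i j 1) =
      𝒟.ρ (Matrix.single (finSumFinEquiv i) (finSumFinEquiv j) (1 : ℂ)) +
        (if finSumFinEquiv i = finSumFinEquiv j then z else 0) • (1 : Module.End ℂ 𝒟.V) := by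
    intro i j
    rw [hτ, Matrix.reindex_apply, Matrix.submatrix_single_equiv, Equiv.symm_symm]
    congr 2
    by_cases h : i = j
    · subst h; rw [if_pos rfl, Matrix.trace_single_eq_same, mul_one]
    · rw [if_neg (fun h' => h (finSumFinEquiv.injective h')), Matrix.trace_single_eq_of_ne _ _ _ h, mul_zero]
  refine ⟨fun v => ?_, fun Z hZ v => ?_⟩
  · /- the Casimir clause: `C_σ = Σ_{a,b} (ρ(E_ab) + zδ_ab)(ρ(E_ba) + zδ_ab)` -/
    have hC : upqCasimirOp σ = ∑ a : Fin 3, ∑ b : Fin 3,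
        (𝒟.ρ (E a b) + (if a = b then z else 0) • (1 : Module.End ℂ 𝒟.V)) *
          (𝒟.ρ (E b a) + (if b = a then z else 0) • (1 : Module.End ℂ 𝒟.V)) := by
      have h := sum_bilin_eq_of_parseval
        (fun t => ((upqBasis (Fin 2) (Fin 1) t : G21.lie) : Matrix (Fin 2 ⊕ Fin 1) (Fin 2 ⊕ Fin 1) ℂ))
        (fun t => ((upqDualBasis (Fin 2) (Fin 1) t : G21.lie) : Matrix (Fin 2 ⊕ Fin 1) (Fin 2 ⊕ Fin 1) ℂ))
        sum_trace_mul_smul_upqDualBasis ((LinearMap.mul ℂ (Module.End ℂ 𝒟.V)).compl₁₂ τ τ)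
      simp only [LinearMap.compl₁₂_apply, LinearMap.mul_apply'] at h
      calc upqCasimirOp σ
          = ∑ t, τ ((upqBasis (Fin 2) (Fin 1) t : G21.lie) : Matrix (Fin 2 ⊕ Fin 1) (Fin 2 ⊕ Fin 1) ℂ) *
              τ ((upqDualBasis (Fin 2) (Fin 1) t : G21.lie) : Matrix (Fin 2 ⊕ Fin 1) (Fin 2 ⊕ Fin 1) ℂ) := by
            rw [upqCasimirOp, GKCasimir.op]
            refine Finset.sum_congr rfl fun t _ => ?_
            rw [hστ, hστ, coe_upqBasis, coe_upqDualBasis]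
            rfl
        _ = ∑ i : Fin 2 ⊕ Fin 1, ∑ j : Fin 2 ⊕ Fin 1, τ (Matrix.single i j 1) * τ (Matrix.single j i 1) := h
        _ = _ := by
            refine Fintype.sum_equiv finSumFinEquiv _ _ fun i => ?_
            refine Fintype.sum_equiv finSumFinEquiv _ _ fun j => ?_
            rw [hτE, hτE]
    -- the four pieces of the expansion
    have hdiag : ∑ a : Fin 3, 𝒟.ρ (E a a) = 0 := by
      rw [← map_sum, sum_single_diag_eq_one, ρ_apply, ρfun_one]
    have h1 : ∑ a : Fin 3, ∑ b : Fin 3, (if b = a then z else 0) • 𝒟.ρ (E a b) = 0 := by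
      simp only [ite_smul, zero_smul, Finset.sum_ite_eq', Finset.mem_univ, if_true]
      rw [← Finset.smul_sum, hdiag, smul_zero]
    have h2 : ∑ a : Fin 3, ∑ b : Fin 3, (if a = b then z else 0) • 𝒟.ρ (E b a) = 0 := by
      simp only [ite_smul, zero_smul, Finset.sum_ite_eq, Finset.mem_univ, if_true]
      rw [← Finset.smul_sum, hdiag, smul_zero]
    have h3 : ∑ a : Fin 3, ∑ b : Fin 3, ((if a = b then z else 0) * (if b = a then z else 0)) • (1 : Module.End ℂ 𝒟.V) =
        (3 * (z * z)) • (1 : Module.End ℂ 𝒟.V) := by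
      have hin : ∀ a : Fin 3, ∑ b : Fin 3, ((if a = b then z else 0) * (if b = a then z else 0)) • (1 : Module.End ℂ 𝒟.V) =
          (z * z) • (1 : Module.End ℂ 𝒟.V) := fun a => by
        rw [Finset.sum_eq_single a (fun b _ hb => by rw [if_neg (Ne.symm hb), zero_mul, zero_smul])
          (fun ha => (ha (Finset.mem_univ a)).elim), if_pos rfl]
      simp only [hin, Finset.sum_const, Finset.card_univ, Fintype.card_fin, ← Nat.cast_smul_eq_nsmul ℂ, smul_smul,
        Nat.cast_ofNat]
    have hexp : ∀ a b : Fin 3,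
        (𝒟.ρ (E a b) + (if a = b then z else 0) • (1 : Module.End ℂ 𝒟.V)) *
            (𝒟.ρ (E b a) + (if b = a then z else 0) • (1 : Module.End ℂ 𝒟.V)) =
          𝒟.ρ (E a b) * 𝒟.ρ (E b a) + (if b = a then z else 0) • 𝒟.ρ (E a b) + (if a = b then z else 0) • 𝒟.ρ (E b a) +
            ((if a = b then z else 0) * (if b = a then z else 0)) • (1 : Module.End ℂ 𝒟.V) := fun a b => by
      rw [add_mul, mul_add, mul_add, mul_smul_comm, mul_one, smul_mul_assoc, one_mul, smul_mul_assoc, one_mul, smul_smul]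
      abel
    have hmain : (∑ a : Fin 3, ∑ b : Fin 3, 𝒟.ρ (E a b) * 𝒟.ρ (E b a)) v = κ₀ • v := by
      rw [← hκ v]
      simp only [LinearMap.sum_apply, Module.End.mul_apply, lie_def, ρ_apply]
    rw [hC]
    simp only [hexp, Finset.sum_add_distrib]
    rw [h1, h2, h3, add_zero, add_zero, LinearMap.add_apply, hmain, LinearMap.smul_apply, Module.End.one_apply, ← add_smul]
    congr 1
    rw [hz]
    ring
  · /- the centre clause: `σ(Z) = ρ(i·1) + z·tr(i·1) = 0 + 3zi = e·i` -/
    rw [hστ Z, hτ, hZ]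
    simp only [Matrix.reindex_apply, Matrix.submatrix_smul, Pi.smul_apply, Matrix.submatrix_one_equiv, map_smul,
      Matrix.trace_smul, Matrix.trace_one, LinearMap.smul_apply, ρ_apply, ρfun_one, smul_zero, zero_add, Module.End.one_apply,
      smul_eq_mul, Fintype.card_sum, Fintype.card_fin]
    congr 1
    rw [hz]
    push_cast
    ring

end Summit.HodgeConjecture.HodgeConjecture.Cruxes.H413.K2E1bTwistChiScalars

end
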